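import Summits.QuantumFields.BalabanUV.T4Continuum.Spine.NE2.OneStepRemainderLoopCoeff

/-!
# T⁴ programme, spine node NE2 (U1a) — R14 W3c, file 8: CONSISTENCY WITNESS — AT THE FLAT BACKGROUND THE SUPPLIED COEFFICIENT DATA VANISH AND THE COMPOSED REMAINDER IS ZERO
# (cell `pub-balaban-gaps`, seat ne2 gen 6; companion of `OneStepRemainderLoopCoeff`, cf. gen 5's `ComposedRemainderFlatWitness`)

[B7] p. 36: «the functions g(−z), g⁻¹(z), e^{iz} are equal to 1 for z = 0» — at a FLAT background the loop `Γ_{c,x} ∪ (−c)` has holonomy `1`, so `Y_x = Y = 0` and (124)'s three coefficient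
operators vanish: `Q(V₀) = Q₀`.  THIS FILE checks that the SUPPLIER `OneStepRemainderLoopCoeff.remCoeffOf` reproduces this: `loopHol 1 = 1`, `Yx 1 = 0`, `Ybar 1 = 0` (`loopHol_one`, `Yx_one`,
`Ybar_one`), `adLie 0 = 0`, the three coefficient shapes vanish at `(0, 0)` (`coeffG₁_zero`, `coeffG₂_zero`, `coeffG₃_zero`), hence for the flat fundamental tower `U ≡ 1` the supplied
`G₁ = G₂ = G₃ = 0` (`remCoeffOf_one_G₁/G₂/G₃`), every one-step remainder `QremStep W (remCoeffOf 1 c e W′) k = 0` for ANY fine transporters `W` and coarse-bond data `W′`, and the composed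
remainder `Erem` vanishes at every level (**`Erem_remCoeffOf_one`**) — the plaquette letter `p = 0` is attained and gen 5's free case is recovered through the supplier.
HONEST FRAMING (T4-DAG p. 1).  [folklore] bookkeeping; non-vacuity/consistency of typed MODEL objects only; nothing of Bałaban's asserted; NOT NE2; **NE2 (U1a) NOT PROVED**; spine PROVED 0/9
unchanged; NOT continuum YM / infinite volume / mass gap / Clay.  No `sorry`.
-/

noncomputable section

open scoped BigOperators ComplexConjugate Matrix Matrix.Norms.L2Operator

namespace Summit.QuantumFields.BalabanUV.T4Continuum.NE2.OneStepRemainderLoopFlat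

open Literature.MathematicalPhysics.QuantumFieldTheory.Balaban1983to89.B5Prop11Plancherel (Tor fine)
open Literature.MathematicalPhysics.QuantumFieldTheory.Balaban1983to89.B5G183RateUnitTower (lev lev_neZero)
open Literature.MathematicalPhysics.QuantumFieldTheory.Balaban1983to89.MatrixLog (mlog mlog_one)
open Summit.QuantumFields.BalabanUV.Beta.ThinLoopHolonomy (cpxHom)
open Summit.QuantumFields.BalabanUV.T4Continuum.BalabanAveragedTowerUnit (idx)
open Summit.QuantumFields.BalabanUV.T4Continuum.CovariantBlockAveraging (transport transport_one)
open Summit.QuantumFields.BalabanUV.T4Continuum.NE2.OneStepLoopHolonomy (loopHol Yx Ybar)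
open Summit.QuantumFields.BalabanUV.T4Continuum.NE2.OneStepRemainder (Qrem_zero_coeff)
open Summit.QuantumFields.BalabanUV.T4Continuum.NE2.OneStepRemainderAdjoint (adLie adLie_apply coeffG₁ coeffG₂ coeffG₃)
open Summit.QuantumFields.BalabanUV.T4Continuum.NE2.OneStepRemainderCoefficients (gFun gFun_zero)
open Summit.QuantumFields.BalabanUV.T4Continuum.NE2.ComposedRemainderTower (RemCoeff QremStep Erem Erem_zero Erem_succ)
open Summit.QuantumFields.BalabanUV.T4Continuum.NE2.OneStepRemainderLoopCoeff (YxT YbarT remCoeffOf sum_blockWeight)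

variable {d : ℕ}

/-! ## §1 The flat background: trivial loop, zero logarithms -/

section Flat

variable (N : ℕ) [NeZero N] (M : Fin d → ℕ) [hM : ∀ μ, NeZero (M μ)] {m : Type*} [Fintype m] [DecidableEq m] (μ : Fin d) (L : ℕ)

omit hM in
/-- at the flat background the loop `Γ_{c,x} ∪ (−c)` has holonomy `1`. [folklore] -/
theorem loopHol_one (ℓ : ℕ) (z : Tor (fine N M)) (r : Fin d → ℕ) : loopHol N M (fun _ _ => (1 : Matrix m m ℂ)) μ ℓ z r = 1 := by
  rw [loopHol, transport_one, transport_one, transport_one, Matrix.one_mul, Matrix.one_mul, Matrix.conjTranspose_one]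

omit hM in
/-- hence `Y_x = 0` … [folklore] -/
theorem Yx_one (z : Tor (fine N M)) (r : Fin d → ℕ) : Yx N M (fun _ _ => (1 : Matrix m m ℂ)) μ L z r = 0 := by
  rw [Yx, loopHol_one, mlog_one, smul_zero]

omit hM in
/-- … and `Y = 0`. [folklore] -/
theorem Ybar_one (z : Tor (fine N M)) : Ybar N M (fun _ _ => (1 : Matrix m m ℂ)) μ L z = 0 := by
  rw [Ybar]
  exact Finset.sum_eq_zero fun r _ => by rw [Yx_one, smul_zero]

end Flat

/-! ## §2 The coefficient shapes vanish at zero logarithms -/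

section Coeff

variable {n : Type} [Fintype n] [DecidableEq n] {ι : Type} [Fintype ι] [DecidableEq ι] [Nonempty ι] (c : ℝ) (e : ι → Matrix n n ℂ)

omit [DecidableEq n] [Fintype ι] [DecidableEq ι] [Nonempty ι] in
/-- `ad_0 = 0`. [folklore] -/
theorem adLie_zero : adLie c e (0 : Matrix n n ℂ) = 0 := by
  ext k i
  rw [adLie_apply, Matrix.zero_mul, Matrix.mul_zero, sub_self, smul_zero, map_zero, Matrix.zero_apply]

omit [DecidableEq n] [Nonempty ι] in
/-- the argument `∓i·ad_0` of the functional calculus is `0`. [folklore] -/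
theorem arg_zero : Complex.I • cpxHom (adLie c e (0 : Matrix n n ℂ)) = 0 := by
  rw [adLie_zero, map_zero, smul_zero]

omit [DecidableEq n] [Nonempty ι] in
/-- `G₁(0, 0) = g(0)g(0)⁻¹ − 1 = 0`. [cite: Balaban1985Averaging, p.36 («equal to 1 for z = 0»)] [folklore] -/
theorem coeffG₁_zero : coeffG₁ c e (0 : Matrix n n ℂ) 0 = 0 := by
  rw [coeffG₁, arg_zero, neg_zero, gFun_zero, Ring.inverse_one, mul_one, sub_self]

omit [DecidableEq n] [Nonempty ι] in
/-- `G₂(0, 0) = g(0)g(0)⁻¹e⁰ − 1 = 0`. [cite: Balaban1985Averaging, p.36] [folklore] -/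
theorem coeffG₂_zero : coeffG₂ c e (0 : Matrix n n ℂ) 0 = 0 := by
  rw [coeffG₂, arg_zero, neg_zero, gFun_zero, Ring.inverse_one, NormedSpace.exp_zero, mul_one, mul_one, sub_self]

omit [DecidableEq n] [Nonempty ι] in
/-- `G₃(0, 0) = e⁰ − g(0)·Σ_x w_x g(0)⁻¹ = 0` for a probability weight. [cite: Balaban1985Averaging, p.36] [folklore] -/
theorem coeffG₃_zero {κ : Type*} (s : Finset κ) {w : κ → ℝ} (hw1 : ∑ x ∈ s, w x = 1) : coeffG₃ s w c e (0 : Matrix n n ℂ) (fun _ => 0) = 0 := by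
  rw [coeffG₃, arg_zero, neg_zero, gFun_zero, Ring.inverse_one, NormedSpace.exp_zero, one_mul, ← Finset.sum_smul, ← Complex.ofReal_sum, hw1, Complex.ofReal_one, one_smul, sub_self]

end Coeff

/-! ## §3 The supplier at the flat tower -/

section Tower

variable (L : ℕ) [NeZero L] (M : Fin d → ℕ) [hM : ∀ μ, NeZero (M μ)] {n : Type} [Fintype n] [DecidableEq n] {ι : Type} [Fintype ι] [DecidableEq ι]
  (c : ℝ) (e : ι → Matrix n n ℂ)

omit hM in
/-- at the flat fundamental tower the loop logarithms vanish. [folklore] -/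
theorem YxT_one (i : ℕ) (x : Tor (fine (lev L i) M)) (μ : Fin d) (r : Fin d → Fin L) : YxT L M (fun _ _ _ => (1 : Matrix n n ℂ)) i x μ r = 0 :=
  Yx_one (L * lev L i) M μ L _ _

omit hM in
/-- … and so does their block mean. [folklore] -/
theorem YbarT_one (i : ℕ) (x : Tor (fine (lev L i) M)) (μ : Fin d) : YbarT L M (fun _ _ _ => (1 : Matrix n n ℂ)) i x μ = 0 :=
  Ybar_one (L * lev L i) M μ L _

omit hM in
/-- **THE SUPPLIED `G₁` VANISHES AT THE FLAT TOWER.** [cite: Balaban1985Averaging, p.36] [folklore] -/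
theorem remCoeffOf_one_G₁ (W : (i : ℕ) → Fin d → (idx L M i → Matrix ι ι ℂ)) (i : ℕ) (x : Tor (fine (lev L i) M)) (μ : Fin d) (r : Fin d → Fin L) :
    (remCoeffOf L M (fun _ _ _ => (1 : Matrix n n ℂ)) c e W).G₁ i x μ r = 0 := by
  show coeffG₁ c e (YbarT L M (fun _ _ _ => (1 : Matrix n n ℂ)) i x μ) (YxT L M (fun _ _ _ => (1 : Matrix n n ℂ)) i x μ r) = 0
  rw [YbarT_one, YxT_one, coeffG₁_zero]

omit hM in
/-- the supplied `G₂` vanishes at the flat tower. [folklore] -/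
theorem remCoeffOf_one_G₂ (W : (i : ℕ) → Fin d → (idx L M i → Matrix ι ι ℂ)) (i : ℕ) (x : Tor (fine (lev L i) M)) (μ : Fin d) (r : Fin d → Fin L) :
    (remCoeffOf L M (fun _ _ _ => (1 : Matrix n n ℂ)) c e W).G₂ i x μ r = 0 := by
  show coeffG₂ c e (YbarT L M (fun _ _ _ => (1 : Matrix n n ℂ)) i x μ) (YxT L M (fun _ _ _ => (1 : Matrix n n ℂ)) i x μ r) = 0
  rw [YbarT_one, YxT_one, coeffG₂_zero]

omit hM in
/-- the supplied `G₃` vanishes at the flat tower (block weight `L^{−d}` is a probability weight). [folklore] -/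
theorem remCoeffOf_one_G₃ (W : (i : ℕ) → Fin d → (idx L M i → Matrix ι ι ℂ)) (i : ℕ) (x : Tor (fine (lev L i) M)) (μ : Fin d) :
    (remCoeffOf L M (fun _ _ _ => (1 : Matrix n n ℂ)) c e W).G₃ i x μ = 0 := by
  show coeffG₃ Finset.univ (fun _ : Fin d → Fin L => ((L : ℝ) ^ d)⁻¹) c e (YbarT L M (fun _ _ _ => (1 : Matrix n n ℂ)) i x μ) (fun r => YxT L M (fun _ _ _ => (1 : Matrix n n ℂ)) i x μ r) = 0
  have h : (fun r => YxT L M (fun _ _ _ => (1 : Matrix n n ℂ)) i x μ r) = fun _ => 0 := funext fun r => YxT_one L M i x μ r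
  rw [YbarT_one, h, coeffG₃_zero c e _ (sum_blockWeight L)]

omit hM in
/-- **EVERY ONE-STEP REMAINDER VANISHES** for the coefficient data supplied at the flat tower, for ANY fine transporters `W` and coarse-bond data `W′`. [folklore] -/
theorem QremStep_remCoeffOf_one (W : (i : ℕ) → Fin d → (idx L M i → Matrix ι ι ℂ)) (W' : (i : ℕ) → Fin d → (idx L M i → Matrix ι ι ℂ)) (k : ℕ) :
    QremStep L M W (remCoeffOf L M (fun _ _ _ => (1 : Matrix n n ℂ)) c e W') k = 0 := by
  haveI := lev_neZero L k
  have h1 : (remCoeffOf L M (fun _ _ _ => (1 : Matrix n n ℂ)) c e W').G₁ k = fun _ _ _ => 0 := by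
    funext x μ r; exact remCoeffOf_one_G₁ L M c e W' k x μ r
  have h2 : (remCoeffOf L M (fun _ _ _ => (1 : Matrix n n ℂ)) c e W').G₂ k = fun _ _ _ => 0 := by
    funext x μ r; exact remCoeffOf_one_G₂ L M c e W' k x μ r
  have h3 : (remCoeffOf L M (fun _ _ _ => (1 : Matrix n n ℂ)) c e W').G₃ k = fun _ _ => 0 := by
    funext x μ; exact remCoeffOf_one_G₃ L M c e W' k x μ
  rw [QremStep, h1, h2, h3]
  exact Qrem_zero_coeff (lev L k) L M (W (k + 1)) _

/-- **THE COMPOSED REMAINDER VANISHES AT EVERY LEVEL** for the coefficient data supplied at the flat tower (induction on `Erem_succ`; gen 5's free case recovered through the supplier). [folklore] -/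
theorem Erem_remCoeffOf_one (W : (i : ℕ) → Fin d → (idx L M i → Matrix ι ι ℂ)) (W' : (i : ℕ) → Fin d → (idx L M i → Matrix ι ι ℂ)) (k : ℕ) :
    Erem L M W (remCoeffOf L M (fun _ _ _ => (1 : Matrix n n ℂ)) c e W') k = 0 := by
  induction k with
  | zero => exact Erem_zero L M W _
  | succ k ih => rw [Erem_succ, ih, QremStep_remCoeffOf_one, Matrix.zero_mul, Matrix.mul_zero, add_zero, smul_zero]

end Tower

end Summit.QuantumFields.BalabanUV.T4Continuum.NE2.OneStepRemainderLoopFlat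

end
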